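import Summits.QuantumFields.YangMills.Theorems.LangevinControlUVOSLegsAtWeakCouplingCStubClusterFrame
import Literature.MathematicalPhysics.QuantumLattice.SchwartzTranslationCutoff
import HarnessLib

/-!
# Stub `stub_cluster` of line `Sketch` (crux stmt-QuantumFields-16207 `OSLegsAtWeakCouplingC`): E4 from the decay

`…Cruxes.OSLegsFromFemtoAndGap.DlrCollarTransfer.stub_cluster : Statement.stub_cluster` (DefsR3 §4.3): for a
one-field Schwinger family `S₁` on `ℝ⁴` with translation invariance and signed-permutation invariance on `⁰𝒮`,
Cauchy–Schwarz `ConnCS S₁` for the connected OS form and exponential decay `Decay S₁ Δ` (`Δ > 0`) of the diagonal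
form in the TIME direction on the dense class, the cluster property E4 holds in every SPATIAL direction `a`
(`a⁰ = 0`, `a ≠ 0`):
* **geometric core** (`tendsto_conn_translateMulti_smul_of_frame`): for an invariance `R` of `S₁` on `⁰𝒮` whose
  time component `v ↦ (Rv)⁰` is blind to the time reflection and positive on `a`, and compactly supported
  time-ordered `A, B`, a spatial pre-shift `c ∥ a` and the rotation rule give
  `conn(A, T_{ta} B) = conn(θRθ·T_c A, T_{tb}(R·T_c B))`, `b = Ra`, `b⁰ > 0`, with `θRθ·T_c A` and
  `T_{t₁ b}(R·T_c B)` compactly supported at positive times and pairwise distinct points — the class of part I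
  (`…StubClusterFrame`), whose `tendsto_conn_translateMulti_of_posSep` concludes;
* the transposition of the axes `0` and `i` (`a_i ≠ 0`; followed by the time reflection if `a_i < 0`) is such an
  `R` and a signed permutation of the axes (`tendsto_conn_translateMulti_smul_of_tsupport_subset`);
* general time-ordered `F, G` by the compact cutoffs of `exists_tsupport_subset_inter_closedBall_tendsto`, `ConnCS`
  and the spatial `conn`-isometry, uniformly in `t` (`tendsto_conn_translateMulti_smul`, `tendsto_of_uniform_approx`);
* `stub_cluster`: the witness `H t` of `ΘF* ⊗ T_{ta} G` is `appendTensor` by extensionality, `S₁(T_{ta} G) = S₁(G)`.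
Refs: OsterwalderSchrader1973 §3 (E4) and Remark 2 (p. 89); GlimmJaffe1987 §19.7; OsterwalderSeiler1978 §3.
-/

set_option autoImplicit false

noncomputable section

open scoped SchwartzMap ComplexConjugate
open MeasureTheory Filter Topology
open Literature.MathematicalPhysics.QuantumFieldTheory Literature.MathematicalPhysics.QuantumLattice
open Literature.MathematicalPhysics.AQFT

namespace Summit.QuantumFields.YangMills.Theorems.OSLegsFromFemtoAndGap

open Summit.QuantumFields.YangMills.Cruxes.OSLegsFromFemtoAndGap.DlrCollarTransfer (conn Decay ConnCS)

variable (S₁ : SchwingerFamily (EuclideanSpace ℝ (Fin 4))) {n m : ℕ}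
  {A F : 𝓢((Fin n → EuclideanSpace ℝ (Fin 4)), ℂ)} {B G : 𝓢((Fin m → EuclideanSpace ℝ (Fin 4)), ℂ)}

/-! ### The axis swap: spatial clustering of compactly supported time-ordered test functions -/

/-- **Geometric core.**  Let `R` be an invariance of `S₁` on `⁰𝒮` whose time component `v ↦ (Rv)⁰` is blind to the
time reflection and positive on the spatial direction `a`.  For compactly supported time-ordered `A, B` (supports in
the ball of radius `ρ`): with the spatial pre-shift `c = −((ρ+1)/(Ra)⁰) a`,
`conn(A, T_{ta} B) = conn(T_c A, T_{c+ta} B) = conn(A′, T_{tb} B′)` (`A′ = θRθ·T_c A`, `B′ = R·T_c B`, `b = Ra`,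
`b⁰ > 0`), where `A′` and `T_{t₁b} B′` (`t₁ b⁰ = 2ρ + 2`) are compactly supported and supported at positive times and
pairwise distinct points; conclude by `tendsto_conn_translateMulti_of_posSep` along `t ↦ t − t₁`. -/
theorem tendsto_conn_translateMulti_smul_of_frame {Δ : ℝ} (hΔ : 0 < Δ)
    (htrans : ∀ (n : ℕ) (t : EuclideanSpace ℝ (Fin 4)) (F : 𝓢((Fin n → EuclideanSpace ℝ (Fin 4)), ℂ)),
      IsOffDiagonal F → S₁ n (translateMulti t F) = S₁ n F)
    (hCS : ConnCS S₁) (hD : Decay S₁ Δ) (R : EuclideanSpace ℝ (Fin 4) ≃ₗᵢ[ℝ] EuclideanSpace ℝ (Fin 4))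
    (hR : ∀ (n : ℕ) (F : 𝓢((Fin n → EuclideanSpace ℝ (Fin 4)), ℂ)),
      IsOffDiagonal F → S₁ n (linActMulti R F) = S₁ n F)
    (hRθ : ∀ v : EuclideanSpace ℝ (Fin 4), R (timeReflection 4 v) 0 = R v 0) {a : EuclideanSpace ℝ (Fin 4)}
    (ha0 : a 0 = 0) (hRa : 0 < R a 0) (hA : IsTimeOrdered A) (hB : IsTimeOrdered B) {ρ : ℝ}
    (hAρ : tsupport ⇑A ⊆ Metric.closedBall 0 ρ) (hBρ : tsupport ⇑B ⊆ Metric.closedBall 0 ρ) :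
    Tendsto (fun t : ℝ => conn S₁ A (translateMulti (t • a) B)) atTop (𝓝 0) := by
  set R' : EuclideanSpace ℝ (Fin 4) ≃ₗᵢ[ℝ] EuclideanSpace ℝ (Fin 4) :=
    (timeReflection 4).trans (R.trans (timeReflection 4)) with hR'_def
  have hR'app : ∀ v, R' v = timeReflection 4 (R (timeReflection 4 v)) := fun v => rfl
  set c : EuclideanSpace ℝ (Fin 4) := (-(ρ + 1) / R a 0) • a with hc_def
  set b : EuclideanSpace ℝ (Fin 4) := R a with hb_def
  set t₁ : ℝ := (2 * ρ + 2) / R a 0 with ht₁_def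
  have hc0 : c 0 = 0 := by simp [hc_def, ha0]
  have hRc : R c 0 = -(ρ + 1) := by
    rw [hc_def, LinearIsometryEquiv.map_smul, PiLp.smul_apply, smul_eq_mul, div_mul_cancel₀ _ hRa.ne']
  have hb0 : 0 < b 0 := hRa
  have ht₁b : t₁ * b 0 = 2 * ρ + 2 := div_mul_cancel₀ _ hRa.ne'
  have hcomp : ∀ v : EuclideanSpace ℝ (Fin 4), |R v 0| ≤ ‖v‖ := fun v => by
    have h := PiLp.norm_apply_le (R v) 0
    rw [Real.norm_eq_abs, LinearIsometryEquiv.norm_map] at h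
    exact h
  have hAc : HasCompactSupport ⇑A := IsCompact.of_isClosed_subset (isCompact_closedBall _ _) (isClosed_tsupport _) hAρ
  have hBc : HasCompactSupport ⇑B := IsCompact.of_isClosed_subset (isCompact_closedBall _ _) (isClosed_tsupport _) hBρ
  set A' := linActMulti R' (translateMulti c A) with hA'_def
  set Q := translateMulti (t₁ • b) (linActMulti R (translateMulti c B)) with hQ_def
  have hA'c : HasCompactSupport ⇑A' := hasCompactSupport_linActMulti (hasCompactSupport_translateMulti hAc c) R'
  have hQc : HasCompactSupport ⇑Q :=
    hasCompactSupport_translateMulti (hasCompactSupport_linActMulti (hasCompactSupport_translateMulti hBc c) R) _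
  -- `A′` is supported at positive times and pairwise distinct points
  have hA'ps : tsupport ⇑A' ⊆ {x | (∀ k, 0 < x k 0) ∧ Function.Injective x} := by
    intro x hx
    set y : Fin n → EuclideanSpace ℝ (Fin 4) := fun k => R'.symm (x k) - c with hy_def
    have hyA : y ∈ tsupport ⇑A := tsupport_translateMulti_subset c A (tsupport_linActMulti_subset R' hx)
    have hxk : ∀ k, x k = R' (y k + c) := fun k => by
      simp only [hy_def, sub_add_cancel, LinearIsometryEquiv.apply_symm_apply]
    have hyρ : ‖y‖ ≤ ρ := mem_closedBall_zero_iff.1 (hAρ hyA)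
    refine ⟨fun k => ?_, fun i j hij => (hA hyA).2.injective ?_⟩
    · have h1 : R' (y k + c) 0 = -(R (y k) 0) + (ρ + 1) := by
        rw [hR'app, OSReconstructionNoE1.timeReflection_apply_zero, hRθ, LinearIsometryEquiv.map_add, PiLp.add_apply,
          hRc]; ring
      have h2 := (abs_le.1 ((hcomp (y k)).trans ((norm_le_pi_norm y k).trans hyρ))).2
      rw [hxk k, h1]; linarith
    · have h : y i = y j := by
        change R'.symm (x i) - c = R'.symm (x j) - c
        rw [hij]
      exact congrArg (fun v : EuclideanSpace ℝ (Fin 4) => v 0) h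
  -- `Q = T_{t₁ b} B′` is supported at positive times and pairwise distinct points
  have hQps : tsupport ⇑Q ⊆ {x | (∀ k, 0 < x k 0) ∧ Function.Injective x} := by
    intro x hx
    set y : Fin m → EuclideanSpace ℝ (Fin 4) := fun k => R.symm (x k - t₁ • b) - c with hy_def
    have hyB : y ∈ tsupport ⇑B :=
      tsupport_translateMulti_subset c B (tsupport_linActMulti_subset R (tsupport_translateMulti_subset _ _ hx))
    have hxk : ∀ k, x k = R (y k + c) + t₁ • b := fun k => by
      simp only [hy_def, sub_add_cancel, LinearIsometryEquiv.apply_symm_apply]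
    have hyρ : ‖y‖ ≤ ρ := mem_closedBall_zero_iff.1 (hBρ hyB)
    refine ⟨fun k => ?_, fun i j hij => (hB hyB).2.injective ?_⟩
    · have h1 : (R (y k + c) + t₁ • b) 0 = R (y k) 0 - (ρ + 1) + (2 * ρ + 2) := by
        rw [PiLp.add_apply, LinearIsometryEquiv.map_add, PiLp.add_apply, hRc, PiLp.smul_apply, smul_eq_mul, ht₁b]
        ring
      have h2 := (abs_le.1 ((hcomp (y k)).trans ((norm_le_pi_norm y k).trans hyρ))).1
      rw [hxk k, h1]; linarith
    · have h : y i = y j := by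
        change R.symm (x i - t₁ • b) - c = R.symm (x j - t₁ • b) - c
        rw [hij]
      exact congrArg (fun v : EuclideanSpace ℝ (Fin 4) => v 0) h
  -- the identity `conn(A, T_{ta} B) = conn(A′, T_{(t − t₁) b} Q)`
  have hident : ∀ t : ℝ, conn S₁ A (translateMulti (t • a) B) = conn S₁ A' (translateMulti ((t - t₁) • b) Q) := by
    intro t
    have hta0 : (0 : ℝ) ≤ (t • a : EuclideanSpace ℝ (Fin 4)) 0 := by simp [ha0]
    have hcta0 : (0 : ℝ) ≤ (c + t • a : EuclideanSpace ℝ (Fin 4)) 0 := by simp [ha0, hc0]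
    have hTB : IsTimeOrdered (translateMulti (t • a) B) := OSReconstructionNoE1.isTimeOrdered_translateMulti hB hta0
    have hcA : IsTimeOrdered (translateMulti c A) := OSReconstructionNoE1.isTimeOrdered_translateMulti hA hc0.ge
    have hcB : IsTimeOrdered (translateMulti (c + t • a) B) :=
      OSReconstructionNoE1.isTimeOrdered_translateMulti hB hcta0
    have h1 : conn S₁ (translateMulti c A) (translateMulti (c + t • a) B) = conn S₁ A (translateMulti (t • a) B) := by
      have h := conn_translateMulti_translateMulti_of_isOffDiagonal S₁ htrans hA.isOffDiagonal hB.isOffDiagonal c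
        (c + t • a)
      rw [OSReconstructionNoE1.timeReflection_of_apply_zero hc0, add_sub_cancel_left] at h
      exact h (OSReconstructionNoE1.isOffDiagonal_appendTensor_osAdjoint hA hTB)
    have h3 : linActMulti R (translateMulti (c + t • a) B) =
        translateMulti (t • b) (linActMulti R (translateMulti c B)) := by
      rw [add_comm, ← translateMulti_translateMulti, linActMulti_translateMulti, LinearIsometryEquiv.map_smul]
    have h4 : translateMulti ((t - t₁) • b) Q = translateMulti (t • b) (linActMulti R (translateMulti c B)) := by
      rw [hQ_def, translateMulti_translateMulti, sub_smul, sub_add_cancel]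
    rw [← h1, conn_eq_conn_linActMulti S₁ R hR hcA.isOffDiagonal hcB.isOffDiagonal
      (OSReconstructionNoE1.isOffDiagonal_appendTensor_osAdjoint hcA hcB), h3, h4]
  have hlim := (tendsto_conn_translateMulti_of_posSep S₁ hΔ htrans hCS hD hA'ps hA'c hQps hQc hb0).comp
    (tendsto_atTop_add_const_right atTop (-t₁) tendsto_id)
  refine hlim.congr fun t => ?_
  simp only [Function.comp_apply, id, ← sub_eq_add_neg]
  exact (hident t).symm

/-- **Spatial clustering of compactly supported time-ordered test functions**: pick an axis `i ≠ 0` with `a_i ≠ 0`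
and apply the geometric core to the transposition of the axes `0, i` (if `a_i > 0`) or to it followed by the time
reflection (if `a_i < 0`) — both are signed permutations of the axes, hence invariances of `S₁` on `⁰𝒮`. -/
theorem tendsto_conn_translateMulti_smul_of_tsupport_subset {Δ : ℝ} (hΔ : 0 < Δ)
    (htrans : ∀ (n : ℕ) (t : EuclideanSpace ℝ (Fin 4)) (F : 𝓢((Fin n → EuclideanSpace ℝ (Fin 4)), ℂ)),
      IsOffDiagonal F → S₁ n (translateMulti t F) = S₁ n F)
    (hsigned : ∀ (n : ℕ) (R : EuclideanSpace ℝ (Fin 4) ≃ₗᵢ[ℝ] EuclideanSpace ℝ (Fin 4)),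
      (∀ i : Fin 4, ∃ j : Fin 4, R (EuclideanSpace.single i 1) = EuclideanSpace.single j 1 ∨
        R (EuclideanSpace.single i 1) = -EuclideanSpace.single j 1) →
      ∀ F : 𝓢((Fin n → EuclideanSpace ℝ (Fin 4)), ℂ), IsOffDiagonal F → S₁ n (linActMulti R F) = S₁ n F)
    (hCS : ConnCS S₁) (hD : Decay S₁ Δ) {a : EuclideanSpace ℝ (Fin 4)} (ha0 : a 0 = 0) (ha : a ≠ 0)
    (hA : IsTimeOrdered A) (hB : IsTimeOrdered B) {ρ : ℝ}
    (hAρ : tsupport ⇑A ⊆ Metric.closedBall 0 ρ) (hBρ : tsupport ⇑B ⊆ Metric.closedBall 0 ρ) :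
    Tendsto (fun t : ℝ => conn S₁ A (translateMulti (t • a) B)) atTop (𝓝 0) := by
  obtain ⟨i, hi⟩ : ∃ i, a i ≠ 0 := by
    by_contra h
    simp only [not_exists, not_not] at h
    exact ha (by ext j; simp [h j])
  have hi0 : i ≠ 0 := fun h => hi (h ▸ ha0)
  set Sw : EuclideanSpace ℝ (Fin 4) ≃ₗᵢ[ℝ] EuclideanSpace ℝ (Fin 4) :=
    LinearIsometryEquiv.piLpCongrLeft 2 ℝ ℝ (Equiv.swap 0 i) with hSw
  have hSw_apply : ∀ (v : EuclideanSpace ℝ (Fin 4)) (k : Fin 4), Sw v k = v (Equiv.swap 0 i k) := fun v k => by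
    simp [hSw, LinearIsometryEquiv.piLpCongrLeft_apply, Equiv.piCongrLeft'_apply, Equiv.symm_swap]
  have hSw_single : ∀ k : Fin 4, Sw (EuclideanSpace.single k 1) = EuclideanSpace.single (Equiv.swap 0 i k) 1 :=
    fun k => by simp [hSw]
  have hSwθ : ∀ v : EuclideanSpace ℝ (Fin 4), Sw (timeReflection 4 v) 0 = Sw v 0 := fun v => by
    simp only [hSw_apply, Equiv.swap_apply_left, timeReflection_apply, if_neg hi0]
  have hSwa : Sw a 0 = a i := by simp only [hSw_apply, Equiv.swap_apply_left]
  have hθ_single : ∀ k : Fin 4,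
      timeReflection 4 (EuclideanSpace.single k (1 : ℝ)) = EuclideanSpace.single k 1 ∨
        timeReflection 4 (EuclideanSpace.single k (1 : ℝ)) = -EuclideanSpace.single k 1 := by
    intro k
    by_cases hk : k = 0
    · subst hk
      refine Or.inr ?_
      ext l
      simp only [timeReflection_apply, PiLp.single_apply, PiLp.neg_apply]
      split_ifs <;> simp
    · exact Or.inl (OSReconstructionNoE1.timeReflection_of_apply_zero (by simp [Ne.symm hk]))
  rcases lt_or_gt_of_ne hi with hneg | hpos
  · refine tendsto_conn_translateMulti_smul_of_frame S₁ hΔ htrans hCS hD (Sw.trans (timeReflection 4))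
      (fun n F hF => hsigned n _ (fun k => ⟨Equiv.swap 0 i k, ?_⟩) F hF) (fun v => ?_) ha0 ?_ hA hB hAρ hBρ
    · rw [LinearIsometryEquiv.trans_apply, hSw_single]
      exact hθ_single _
    · change timeReflection 4 (Sw (timeReflection 4 v)) 0 = timeReflection 4 (Sw v) 0
      rw [OSReconstructionNoE1.timeReflection_apply_zero, OSReconstructionNoE1.timeReflection_apply_zero, hSwθ]
    · change 0 < timeReflection 4 (Sw a) 0
      rw [OSReconstructionNoE1.timeReflection_apply_zero, hSwa]; linarith
  · exact tendsto_conn_translateMulti_smul_of_frame S₁ hΔ htrans hCS hD Sw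
      (fun n F hF => hsigned n _ (fun k => ⟨_, Or.inl (hSw_single k)⟩) F hF) hSwθ ha0 (hSwa ▸ hpos) hA hB hAρ hBρ

/-- **Spatial clustering of the connected OS form** for general time-ordered `F, G`: approximate by the compact
cutoffs `u_k → F`, `v_k → G` (supported inside `tsupport F`, `tsupport G`, hence time-ordered), bound
`‖conn(u_k, T_{ta} v_k) − conn(F, T_{ta} G)‖ ≤ ‖conn(u_k − F, T_{ta} v_k)‖ + ‖conn(F, T_{ta}(v_k − G))‖` uniformly
in `t` by `ConnCS` and the spatial `conn`-isometry, and pass to the limit (`tendsto_of_uniform_approx`). -/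
theorem tendsto_conn_translateMulti_smul {Δ : ℝ} (hΔ : 0 < Δ)
    (htrans : ∀ (n : ℕ) (t : EuclideanSpace ℝ (Fin 4)) (F : 𝓢((Fin n → EuclideanSpace ℝ (Fin 4)), ℂ)),
      IsOffDiagonal F → S₁ n (translateMulti t F) = S₁ n F)
    (hsigned : ∀ (n : ℕ) (R : EuclideanSpace ℝ (Fin 4) ≃ₗᵢ[ℝ] EuclideanSpace ℝ (Fin 4)),
      (∀ i : Fin 4, ∃ j : Fin 4, R (EuclideanSpace.single i 1) = EuclideanSpace.single j 1 ∨
        R (EuclideanSpace.single i 1) = -EuclideanSpace.single j 1) →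
      ∀ F : 𝓢((Fin n → EuclideanSpace ℝ (Fin 4)), ℂ), IsOffDiagonal F → S₁ n (linActMulti R F) = S₁ n F)
    (hCS : ConnCS S₁) (hD : Decay S₁ Δ) (hF : IsTimeOrdered F) (hG : IsTimeOrdered G)
    {a : EuclideanSpace ℝ (Fin 4)} (ha0 : a 0 = 0) (ha : a ≠ 0) :
    Tendsto (fun t : ℝ => conn S₁ F (translateMulti (t • a) G)) atTop (𝓝 0) := by
  obtain ⟨u, hu_supp, hu_lim⟩ := exists_tsupport_subset_inter_closedBall_tendsto F
  obtain ⟨v, hv_supp, hv_lim⟩ := exists_tsupport_subset_inter_closedBall_tendsto G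
  have huT : ∀ k, IsTimeOrdered (u k) := fun k => ((hu_supp k).trans Set.inter_subset_left).trans hF
  have hvT : ∀ k, IsTimeOrdered (v k) := fun k => ((hv_supp k).trans Set.inter_subset_left).trans hG
  have hta : ∀ t : ℝ, (t • a : EuclideanSpace ℝ (Fin 4)) 0 = 0 := fun t => by simp [ha0]
  have hT : ∀ (t : ℝ) {X : 𝓢((Fin m → EuclideanSpace ℝ (Fin 4)), ℂ)}, IsTimeOrdered X →
      IsTimeOrdered (translateMulti (t • a) X) :=
    fun t X hX => OSReconstructionNoE1.isTimeOrdered_translateMulti hX (hta t).ge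
  have hiso : ∀ (t : ℝ) {X : 𝓢((Fin m → EuclideanSpace ℝ (Fin 4)), ℂ)}, IsTimeOrdered X →
      conn S₁ (translateMulti (t • a) X) (translateMulti (t • a) X) = conn S₁ X X := fun t X hX =>
    conn_translateMulti_self_of_apply_zero S₁ htrans hX.isOffDiagonal
      (OSReconstructionNoE1.isOffDiagonal_appendTensor_osAdjoint hX hX) (hta t)
  have hcs : ∀ {X : 𝓢((Fin n → EuclideanSpace ℝ (Fin 4)), ℂ)} {Y : 𝓢((Fin m → EuclideanSpace ℝ (Fin 4)), ℂ)},
      IsTimeOrdered X → IsTimeOrdered Y → ‖conn S₁ X Y‖ ≤ Real.sqrt ((conn S₁ X X).re * (conn S₁ Y Y).re) := by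
    intro X Y hX hY
    obtain ⟨-, -, h⟩ := hCS n m X Y hX.isPositiveTimeMulti hX.isOffDiagonal hY.isPositiveTimeMulti hY.isOffDiagonal
    calc ‖conn S₁ X Y‖ = Real.sqrt (‖conn S₁ X Y‖ ^ 2) := (Real.sqrt_sq (norm_nonneg _)).symm
      _ ≤ _ := Real.sqrt_le_sqrt h
  refine tendsto_of_uniform_approx (ck := fun k t => conn S₁ (u k) (translateMulti (t • a) (v k))) (ℓk := fun _ => 0)
    (ε := fun k => Real.sqrt ((conn S₁ (u k - F) (u k - F)).re * (conn S₁ (v k) (v k)).re) +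
      Real.sqrt ((conn S₁ F F).re * (conn S₁ (v k - G) (v k - G)).re))
    (fun k => ?_) (fun k t => ?_) ?_ tendsto_const_nhds
  · exact tendsto_conn_translateMulti_smul_of_tsupport_subset S₁ hΔ htrans hsigned hCS hD ha0 ha (huT k) (hvT k)
      ((hu_supp k).trans Set.inter_subset_right) ((hv_supp k).trans Set.inter_subset_right)
  · have hsplit : conn S₁ (u k) (translateMulti (t • a) (v k)) - conn S₁ F (translateMulti (t • a) G) =
        conn S₁ (u k - F) (translateMulti (t • a) (v k)) + conn S₁ F (translateMulti (t • a) (v k - G)) := by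
      rw [conn_sub_left, map_sub, conn_sub_right]; ring
    rw [hsplit]
    refine (norm_add_le _ _).trans (add_le_add ?_ ?_)
    · have h := hcs (isTimeOrdered_sub (huT k) hF) (hT t (hvT k))
      rwa [hiso t (hvT k)] at h
    · have h := hcs hF (hT t (isTimeOrdered_sub (hvT k) hG))
      rwa [hiso t (isTimeOrdered_sub (hvT k) hG)] at h
  · have h0n : conn S₁ (0 : 𝓢((Fin n → EuclideanSpace ℝ (Fin 4)), ℂ))
        (0 : 𝓢((Fin n → EuclideanSpace ℝ (Fin 4)), ℂ)) = 0 := conn_zero_left S₁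
    have h0m : conn S₁ (0 : 𝓢((Fin m → EuclideanSpace ℝ (Fin 4)), ℂ))
        (0 : 𝓢((Fin m → EuclideanSpace ℝ (Fin 4)), ℂ)) = 0 := conn_zero_left S₁
    have hsubF : Tendsto (fun k => u k - F) atTop (𝓝 0) := by simpa using hu_lim.sub_const F
    have hsubG : Tendsto (fun k => v k - G) atTop (𝓝 0) := by simpa using hv_lim.sub_const G
    have h1 : Tendsto (fun k => (conn S₁ (u k - F) (u k - F)).re) atTop (𝓝 0) := by
      have h := (Complex.continuous_re.tendsto _).comp (((continuous_conn_self S₁ n).tendsto 0).comp hsubF)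
      rwa [h0n, Complex.zero_re] at h
    have h2 : Tendsto (fun k => (conn S₁ (v k - G) (v k - G)).re) atTop (𝓝 0) := by
      have h := (Complex.continuous_re.tendsto _).comp (((continuous_conn_self S₁ m).tendsto 0).comp hsubG)
      rwa [h0m, Complex.zero_re] at h
    have h3 : Tendsto (fun k => (conn S₁ (v k) (v k)).re) atTop (𝓝 (conn S₁ G G).re) :=
      (Complex.continuous_re.tendsto _).comp (((continuous_conn_self S₁ m).tendsto G).comp hv_lim)
    have h := ((h1.mul h3).sqrt).add ((tendsto_const_nhds (x := (conn S₁ F F).re)).mul h2).sqrt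
    simpa using h

end Summit.QuantumFields.YangMills.Theorems.OSLegsFromFemtoAndGap

namespace Summit.QuantumFields.YangMills.Cruxes.OSLegsFromFemtoAndGap.DlrCollarTransfer

open Summit.QuantumFields.YangMills.Theorems.OSLegsFromFemtoAndGap

/-- **`stub_cluster`**: E4 in every spatial direction from translation and signed-permutation invariance on `⁰𝒮`,
`ConnCS` and `Decay Δ` (`Δ > 0`); the witness `H t` of `ΘF* ⊗ T_{ta} G` is `appendTensor` by extensionality and
`S₁(T_{ta} G) = S₁(G)`, so the E4 quantity is `conn S₁ F (T_{ta} G)` (`tendsto_conn_translateMulti_smul`). -/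
theorem stub_cluster : Statement.stub_cluster := by
  intro S₁ Δ hΔ _hN _h1 htrans hsigned hCS hD n m k k' F G hF hG a ha0 ha H hH
  have hHeq : ∀ t, H t = (osAdjoint F).appendTensor (translateMulti (t • a) G) := fun t => by
    ext x; rw [hH t x, SchwartzMap.appendTensor_apply]
  have hred : ∀ t, S₁ (n + m) (H t) - S₁ n (osAdjoint F) * S₁ m G = conn S₁ F (translateMulti (t • a) G) :=
    fun t => by rw [hHeq t, conn, htrans m _ _ hG.isOffDiagonal]
  simp only [SchwingerFamily.toLabelled_apply, hred]
  exact tendsto_conn_translateMulti_smul S₁ hΔ htrans hsigned hCS hD hF hG ha0 ha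

end Summit.QuantumFields.YangMills.Cruxes.OSLegsFromFemtoAndGap.DlrCollarTransfer

end
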